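import Literature.Geometry.Kaehler.ComplexTorusMinimalClasses
import HarnessLib

/-!
# The minimal classes `γ_q = θ^{∧q}/(q!·d₁⋯d_q)` of a polarised complex torus are invariant under scaling the polarisation:
# `γ_q(N·η) = γ_q(η) = γ_q(d₁⁻¹·η)` — the integral Lefschetz theory depends only on the reduced type `(1, d₂/d₁, …, d_g/d₁)`

Layer `Literature/Geometry/Kaehler`, namespace `Literature.Geometry.Kaehler.ComplexTorus`; lane `lit-hodgefound` (Track 2
foundations library), seat p09, generation 41, row g41-#7. THEOREMS ONLY (0 definitions); no named fact, net debt 0. Sequel of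
g36-#1 `ComplexTorusMinimalClasses` (`θ^{∧q} = (q!·d₁⋯d_q)·γ_q` with `γ_q` integral and primitive), companion of
`ComplexTorusComplementaryExponentsProduct` §1 (`IsRiemannForm.natCast_smul`, `IsPolarizationType.natCast_smul`: `N·η` is a Riemann
form of type `(N d₁, …, N d_g)`) and `ComplexTorusDualPolarizationIsogeny` Part B (`IsPolarizationType.smul_inv_first`: `d₁⁻¹·η` has type
`(1, d₂/d₁, …, d_g/d₁)`) — here on a FIXED symplectic enumeration, with the Riemann-form property of `d₁⁻¹·η` and the effect on the
divided powers.

Sources (the statements being made precise over `ℤ`):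

* Lange 2023 §1.5.1 (PDF pp. 51–52): the type `(d₁, …, d_g)`, `d₁ ∣ ⋯ ∣ d_g`, = the elementary divisors of `E = Im H` on `Λ`; so `N·E` has
  type `(N d₁, …, N d_g)` and `d₁⁻¹·E` — still integral on `Λ`, since all values of `E` lie in `d₁ℤ` — has type `(1, d₂/d₁, …, d_g/d₁)`;
  §2.5.3 Thm. 2.5.16 / Cor. 2.5.17 (PDF p. 135): `θ^{∧q} = q!·Σ d_{t₁}⋯d_{t_q} dx…`, whence the content `q!·d₁⋯d_q` and the minimal class
  `γ_q = θ^{∧q}/(q!·d₁⋯d_q)`; §4.1 (PDF p. 204: abelian variety = torus with a polarisation; any positive multiple is again one);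
* Benoist–Debarre 2023 §1 (p. 3): "the minimal cohomology class `θ^c/c!`" (principal case);
* Warner GTM94 2.6 (`(cθ)^{∧q} = c^q θ^{∧q}`).

THE POINT. `(cθ)^{∧q} = c^q·θ^{∧q}` and the content scales the same way: `q!·∏_{i<q}(N d_i) = N^q·(q!·∏ d_i)`,
`q!·∏_{i<q}(d_i/d₁)·d₁^q = q!·∏ d_i`. Hence the DIVIDED powers agree:

  **`θ_N^{∧q} = (q!·∏(N d_i))·γ ⟺ θ^{∧q} = (q!·∏ d_i)·γ ⟺ θ'^{∧q} = (q!·∏(d_i/d₁))·γ`** (`θ_N = ofRealForm (N·η)`, `θ' = ofRealForm (d₁⁻¹·η)`),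

so every theorem of the integral Lefschetz package stated "for `γ` with `θ^{∧q} = (q!·d₁⋯d_q)·γ`" (g36–g41) applies verbatim to `N·η` and to
the reduced polarisation `d₁⁻¹·η` of type `(1, d₂/d₁, …, d_g/d₁)` with the SAME classes `γ_q`: the minimal classes, the Lefschetz sublattices
`γ_q ∧ Hᵏ(X, ℤ)`, their indices, cokernels and Gram matrices are invariants of the ray `ℚ_{>0}·η ∩ NS(X)`.

## Contents (theorems only; `g = j + 1`, symplectic enumeration `e₀ : Fin g ⊕ Fin g ≃ ι`)

* §1 scaling a symplectic enumeration: `IsSymplecticEnum.natCast_smul` (`N·η`, type `N·d`), `IsSymplecticEnum.inv_smul_first` (`d₁⁻¹·η`, type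
  `d/d₁`), `IsSymplecticEnum.isRiemannForm_inv_smul_first` (`d₁⁻¹·η` is a Riemann form), `IsSymplecticEnum.inv_smul_first_apply_zero` (its
  first type entry is `1`).
* §2 scaling the divided powers: `wedgePow_ofRealForm_smul` (`(cθ)^{∧q} = c^q θ^{∧q}`), the content identities, and the equivalences
  `wedgePow_natCast_smul_eq_content_smul_iff`, `IsSymplecticEnum.wedgePow_inv_smul_first_eq_content_smul_iff`.
* §3 the common minimal class: `IsSymplecticEnum.exists_mem_integralForms_wedgePow_eq_content_smul_and_smul` (one integral `γ_q` serving
  `η`, `N·η` and `d₁⁻¹·η`), uniqueness across the ray, and the basis-free (`IsPolarizationType`) forms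
  (`IsPolarizationType.wedgePow_inv_smul_first_eq_content_smul_iff`, `…isRiemannForm_inv_smul_first`, `…_and_smul`).

## References

* [cite: Lange2023AbelianVarietiesComplex, §1.5.1 (PDF pp. 51–52); §2.5.3 Thm. 2.5.16 and Cor. 2.5.17 (PDF p. 135); §4.1 (PDF p. 204)]
* [cite: BenoistDebarre2023SmoothSubvarietiesJacobians, §1 (p. 3)]
* [cite: WarnerGTM94, 2.6]
-/

noncomputable section

open Module Function
open Literature.LinearAlgebra.Alternating

namespace Literature.Geometry.Kaehler.ComplexTorus

section Scaling

variable {ι : Type*} [Fintype ι] [DecidableEq ι] {E : Type*} [NormedAddCommGroup E] [NormedSpace ℂ E]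
  (Φ : (ι → ℝ) ≃L[ℝ] E) {j : ℕ} {e₀ : Fin (j + 1) ⊕ Fin (j + 1) ≃ ι} {η : E [⋀^Fin 2]→L[ℝ] ℝ} {d : Fin (j + 1) → ℕ}

/-! ## §1 Scaling a symplectic enumeration -/

omit [Fintype ι] in
/-- **`N·η` is symplectically enumerated by the same basis, with type `(N d₁, …, N d_g)`.** [cite: Lange2023AbelianVarietiesComplex, §1.5.1 (PDF pp. 51–52)] -/
theorem IsSymplecticEnum.natCast_smul (h : IsSymplecticEnum Φ e₀ η d) (N : ℕ) :
    IsSymplecticEnum Φ e₀ ((N : ℝ) • η) (fun i ↦ N * d i) := by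
  refine ⟨fun i i' hii' ↦ Nat.mul_dvd_mul_left N (h.dvd i i' hii'), fun i i' ↦ ?_, fun i i' ↦ ?_, fun i i' ↦ ?_⟩
  · rw [ContinuousAlternatingMap.smul_apply, h.left_left, smul_zero]
  · rw [ContinuousAlternatingMap.smul_apply, h.right_right, smul_zero]
  · rw [ContinuousAlternatingMap.smul_apply, h.left_right, smul_eq_mul]
    split_ifs
    · rw [Nat.cast_mul]
    · rw [mul_zero]

omit [Fintype ι] in
/-- **`d₁⁻¹·η` is symplectically enumerated by the same basis, with the REDUCED type `(1, d₂/d₁, …, d_g/d₁)`** (`d₁ ∣ d_i`; cf.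
`IsPolarizationType.smul_inv_first` for the basis-free form). [cite: Lange2023AbelianVarietiesComplex, §1.5.1 (PDF pp. 51–52)] -/
theorem IsSymplecticEnum.inv_smul_first (h : IsSymplecticEnum Φ e₀ η d) (h0 : 0 < d 0) :
    IsSymplecticEnum Φ e₀ (((d 0 : ℕ) : ℝ)⁻¹ • η) (fun i ↦ d i / d 0) := by
  have h0' : ((d 0 : ℕ) : ℝ) ≠ 0 := by exact_mod_cast h0.ne'
  refine ⟨fun i i' hii' ↦ ?_, fun i i' ↦ ?_, fun i i' ↦ ?_, fun i i' ↦ ?_⟩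
  · obtain ⟨s, hs⟩ := h.dvd 0 i (Fin.zero_le _)
    obtain ⟨t, ht⟩ := h.dvd i i' hii'
    refine ⟨t, ?_⟩
    rw [ht, hs, mul_assoc, Nat.mul_div_cancel_left _ h0, Nat.mul_div_cancel_left _ h0]
  · rw [ContinuousAlternatingMap.smul_apply, h.left_left, smul_zero]
  · rw [ContinuousAlternatingMap.smul_apply, h.right_right, smul_zero]
  · rw [ContinuousAlternatingMap.smul_apply, h.left_right, smul_eq_mul]
    split_ifs with hii'
    · subst hii'
      rw [Nat.cast_div (h.dvd 0 i (Fin.zero_le _)) h0', div_eq_inv_mul]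
    · rw [mul_zero]

omit [Fintype ι] in
/-- The reduced type starts with `1`: `(d/d₁)₁ = 1`. [cite: Lange2023AbelianVarietiesComplex, §1.5.1 (PDF pp. 51–52)] -/
theorem IsSymplecticEnum.div_first_apply_zero (h0 : 0 < d 0) : (fun i ↦ d i / d 0) 0 = 1 :=
  Nat.div_self h0

/-- **`d₁⁻¹·η` is again a Riemann form** (type `(1,1)` and positivity are homogeneous; integrality on the lattice because all values of `η`
lie in `d₁ℤ` — `d₁⁻¹·η` has a symplectic enumeration of integral type). [cite: Lange2023AbelianVarietiesComplex, §1.5.1 (PDF pp. 51–52); §4.1 (PDF p. 204)] -/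
theorem IsSymplecticEnum.isRiemannForm_inv_smul_first (h : IsSymplecticEnum Φ e₀ η d) (hη : IsRiemannForm Φ η) :
    IsRiemannForm Φ (((d 0 : ℕ) : ℝ)⁻¹ • η) := by
  have h0 : 0 < d 0 := h.pos hη 0
  have h0' : (0 : ℝ) < ((d 0 : ℕ) : ℝ) := by exact_mod_cast h0
  refine ⟨fun u v ↦ ?_, fun m n ↦ (h.inv_smul_first Φ h0).isPolarizationType.integral Φ m n, fun u hu ↦ ?_⟩
  · rw [ContinuousAlternatingMap.smul_apply, ContinuousAlternatingMap.smul_apply, hη.1]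
  · rw [ContinuousAlternatingMap.smul_apply, smul_eq_mul]
    exact mul_pos (inv_pos.2 h0') (hη.2.2 u hu)

/-! ## §2 Scaling the divided powers `θ^{∧q}` -/

omit [Fintype ι] [DecidableEq ι] in
/-- **`(c·θ)^{∧q} = c^q·θ^{∧q}`** for `θ = ofRealForm η` and a real scalar `c`. [cite: WarnerGTM94, 2.6] -/
theorem wedgePow_ofRealForm_smul (c : ℝ) (η : E [⋀^Fin 2]→L[ℝ] ℝ) (q : ℕ) :
    wedgePow (ofRealForm (c • η)) q = ((c : ℂ) ^ q) • wedgePow (ofRealForm η) q := by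
  rw [ofRealForm_smul, wedgePow_smul]

/-- The content scales by `N^q`: `q!·∏_{i<q} (N d_i) = N^q·(q!·∏_{i<q} d_i)`. [cite: Lange2023AbelianVarietiesComplex, §2.5.3 Thm. 2.5.16 (PDF p. 135)] -/
private theorem content_natCast_mul₄₈ (N : ℕ) {q g : ℕ} (hq : q ≤ g) (d : Fin g → ℕ) :
    q.factorial * ∏ i : Fin q, N * d (Fin.castLE hq i) = N ^ q * (q.factorial * ∏ i : Fin q, d (Fin.castLE hq i)) := by
  rw [Finset.prod_mul_distrib, Finset.prod_const, Finset.card_univ, Fintype.card_fin]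
  ring

/-- The content of the reduced type: `(q!·∏_{i<q} (d_i/d₁))·d₁^q = q!·∏_{i<q} d_i` (`d₁ ∣ d_i`).
[cite: Lange2023AbelianVarietiesComplex, §2.5.3 Thm. 2.5.16 (PDF p. 135); §1.5.1 (PDF p. 51)] -/
private theorem content_div_mul_pow₄₈ {q : ℕ} (hq : q ≤ j + 1) (hdvd : ∀ i, d 0 ∣ d i) :
    (q.factorial * ∏ i : Fin q, d (Fin.castLE hq i) / d 0) * d 0 ^ q = q.factorial * ∏ i : Fin q, d (Fin.castLE hq i) := by
  have hpow : d 0 ^ q = ∏ _i : Fin q, d 0 := by simp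
  have hprod : (∏ i : Fin q, d (Fin.castLE hq i) / d 0) * d 0 ^ q = ∏ i : Fin q, d (Fin.castLE hq i) := by
    rw [hpow, ← Finset.prod_mul_distrib]
    exact Finset.prod_congr rfl fun i _ ↦ Nat.div_mul_cancel (hdvd _)
  rw [mul_assoc, hprod]

omit [Fintype ι] [DecidableEq ι] in
/-- **The divided powers of `N·η` and of `η` agree: `θ_N^{∧q} = (q!·∏(N d_i))·γ ⟺ θ^{∧q} = (q!·∏ d_i)·γ`** (`N ≥ 1`, `θ_N = ofRealForm (N·η)`;
both contents scale by `N^q`). [cite: Lange2023AbelianVarietiesComplex, §2.5.3 Thm. 2.5.16 and Cor. 2.5.17 (PDF p. 135); §1.5.1 (PDF pp. 51–52)] [cite: BenoistDebarre2023SmoothSubvarietiesJacobians, §1 (p. 3)] -/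
theorem wedgePow_natCast_smul_eq_content_smul_iff {N : ℕ} (hN : N ≠ 0) {q g : ℕ} (hq : q ≤ g) (d : Fin g → ℕ) (η : E [⋀^Fin 2]→L[ℝ] ℝ)
    (γ : E [⋀^Fin (2 * q)]→L[ℝ] ℂ) :
    wedgePow (ofRealForm ((N : ℝ) • η)) q = ((q.factorial * ∏ i : Fin q, N * d (Fin.castLE hq i) : ℕ) : ℂ) • γ ↔
      wedgePow (ofRealForm η) q = ((q.factorial * ∏ i : Fin q, d (Fin.castLE hq i) : ℕ) : ℂ) • γ := by
  have hNq : ((N : ℂ) ^ q) ≠ 0 := pow_ne_zero _ (Nat.cast_ne_zero.2 hN)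
  rw [wedgePow_ofRealForm_smul, Complex.ofReal_natCast, content_natCast_mul₄₈, Nat.cast_mul, Nat.cast_pow, mul_smul]
  exact (smul_right_injective (E [⋀^Fin (2 * q)]→L[ℝ] ℂ) hNq).eq_iff

omit [Fintype ι] [DecidableEq ι] in
/-- Core of the reduced-type comparison (only `d₁ ∣ d_i` and `d₁ > 0` are used). [cite: Lange2023AbelianVarietiesComplex, §2.5.3 Thm. 2.5.16 (PDF p. 135); §1.5.1 (PDF pp. 51–52)] -/
private theorem wedgePow_inv_smul_first_eq_content_smul_iff₄₈ (hdvd : ∀ i, d 0 ∣ d i) (h0 : 0 < d 0) {q : ℕ} (hq : q ≤ j + 1)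
    (η : E [⋀^Fin 2]→L[ℝ] ℝ) (γ : E [⋀^Fin (2 * q)]→L[ℝ] ℂ) :
    wedgePow (ofRealForm ((((d 0 : ℕ) : ℝ))⁻¹ • η)) q = ((q.factorial * ∏ i : Fin q, d (Fin.castLE hq i) / d 0 : ℕ) : ℂ) • γ ↔
      wedgePow (ofRealForm η) q = ((q.factorial * ∏ i : Fin q, d (Fin.castLE hq i) : ℕ) : ℂ) • γ := by
  have hdq : (((d 0 : ℕ) : ℂ) ^ q) ≠ 0 := pow_ne_zero _ (Nat.cast_ne_zero.2 h0.ne')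
  have hC : ((q.factorial * ∏ i : Fin q, d (Fin.castLE hq i) : ℕ) : ℂ) =
      ((q.factorial * ∏ i : Fin q, d (Fin.castLE hq i) / d 0 : ℕ) : ℂ) * ((d 0 : ℕ) : ℂ) ^ q := by
    rw [← content_div_mul_pow₄₈ (d := d) hq hdvd]
    push_cast
    ring
  rw [wedgePow_ofRealForm_smul, Complex.ofReal_inv, Complex.ofReal_natCast, hC, inv_pow]
  constructor
  · intro hγ
    have h' := congrArg (fun z ↦ (((d 0 : ℕ) : ℂ) ^ q) • z) hγ
    simp only [smul_smul, mul_inv_cancel₀ hdq, one_smul] at h'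
    rw [h', mul_comm (((d 0 : ℕ) : ℂ) ^ q)]
  · intro hγ
    rw [hγ, smul_smul, mul_comm _ (((d 0 : ℕ) : ℂ) ^ q), ← mul_assoc, inv_mul_cancel₀ hdq, one_mul]

omit [Fintype ι] in
/-- **The divided powers of the reduced polarisation `d₁⁻¹·η` and of `η` agree:
`θ'^{∧q} = (q!·∏_{i<q}(d_i/d₁))·γ ⟺ θ^{∧q} = (q!·∏_{i<q} d_i)·γ`** (`θ' = ofRealForm (d₁⁻¹·η)`, `q ≤ g = j + 1`): the minimal classes
`γ_q` are the same for `η` and for `d₁⁻¹·η`. [cite: Lange2023AbelianVarietiesComplex, §2.5.3 Thm. 2.5.16 and Cor. 2.5.17 (PDF p. 135); §1.5.1 (PDF pp. 51–52)] [cite: BenoistDebarre2023SmoothSubvarietiesJacobians, §1 (p. 3)] -/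
theorem IsSymplecticEnum.wedgePow_inv_smul_first_eq_content_smul_iff (h : IsSymplecticEnum Φ e₀ η d) (h0 : 0 < d 0) {q : ℕ}
    (hq : q ≤ j + 1) (γ : E [⋀^Fin (2 * q)]→L[ℝ] ℂ) :
    wedgePow (ofRealForm ((((d 0 : ℕ) : ℝ))⁻¹ • η)) q = ((q.factorial * ∏ i : Fin q, d (Fin.castLE hq i) / d 0 : ℕ) : ℂ) • γ ↔
      wedgePow (ofRealForm η) q = ((q.factorial * ∏ i : Fin q, d (Fin.castLE hq i) : ℕ) : ℂ) • γ :=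
  wedgePow_inv_smul_first_eq_content_smul_iff₄₈ (fun i ↦ h.dvd 0 i (Fin.zero_le _)) h0 hq η γ

omit [Fintype ι] [DecidableEq ι] in
/-- **Basis-free form**: for a Riemann form of type `(d₁, …, d_g)` on a torus presented by ANY lattice basis, the divided powers of `d₁⁻¹·η`
and of `η` agree (`g = j + 1`). [cite: Lange2023AbelianVarietiesComplex, §2.5.3 Thm. 2.5.16 (PDF p. 135); §1.5.1 (PDF pp. 51–52)] -/
theorem IsPolarizationType.wedgePow_inv_smul_first_eq_content_smul_iff {Φ : (ι → ℝ) ≃L[ℝ] E} (hd : IsPolarizationType Φ η d)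
    (h0 : 0 < d 0) {q : ℕ} (hq : q ≤ j + 1) (γ : E [⋀^Fin (2 * q)]→L[ℝ] ℂ) :
    wedgePow (ofRealForm ((((d 0 : ℕ) : ℝ))⁻¹ • η)) q = ((q.factorial * ∏ i : Fin q, d (Fin.castLE hq i) / d 0 : ℕ) : ℂ) • γ ↔
      wedgePow (ofRealForm η) q = ((q.factorial * ∏ i : Fin q, d (Fin.castLE hq i) : ℕ) : ℂ) • γ :=
  wedgePow_inv_smul_first_eq_content_smul_iff₄₈ (fun i ↦ hd.dvd (Fin.zero_le i)) h0 hq η γ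

/-- **Basis-free form: `d₁⁻¹·η` is a Riemann form** for a Riemann form `η` of type `(d₁, …, d_g)` on a torus presented by any lattice basis
(`g = j + 1`). [cite: Lange2023AbelianVarietiesComplex, §1.5.1 (PDF pp. 51–52); §4.1 (PDF p. 204)] -/
theorem IsPolarizationType.isRiemannForm_inv_smul_first {Φ : (ι → ℝ) ≃L[ℝ] E} (hd : IsPolarizationType Φ η d) (hη : IsRiemannForm Φ η) :
    IsRiemannForm Φ (((d 0 : ℕ) : ℝ)⁻¹ • η) := by
  obtain ⟨Φ', hΛ, hs⟩ := hd.exists_isSymplecticEnum Φ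
  exact (hs.isRiemannForm_inv_smul_first Φ' (hη.of_range_latticeVec_subset hΛ.le)).of_range_latticeVec_subset hΛ.ge

/-! ## §3 One integral class serves `η`, `N·η` and `d₁⁻¹·η` -/

/-- **The common minimal class**: for a symplectic enumeration of type `(d₁, …, d_g)` (`g = j + 1`), `q ≤ g` and `N ≥ 1` there is ONE integral
class `γ_q ∈ H^{2q}(X, ℤ)` with `θ^{∧q} = (q!·∏ d_i)·γ_q`, `θ_N^{∧q} = (q!·∏(N d_i))·γ_q` and `θ'^{∧q} = (q!·∏(d_i/d₁))·γ_q` — the minimal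
classes, hence the integral Lefschetz sublattices `γ_q ∧ Hᵏ(X, ℤ)` with their indices, cokernels and Gram matrices (g36–g41), are invariants
of the ray `ℚ_{>0}·η`. [cite: Lange2023AbelianVarietiesComplex, §2.5.3 Thm. 2.5.16 and Cor. 2.5.17 (PDF p. 135); §1.5.1 (PDF pp. 51–52); §4.1 (PDF p. 204)] [cite: BenoistDebarre2023SmoothSubvarietiesJacobians, §1 (p. 3)] -/
theorem IsSymplecticEnum.exists_mem_integralForms_wedgePow_eq_content_smul_and_smul (h : IsSymplecticEnum Φ e₀ η d)
    (hη : IsRiemannForm Φ η) {q : ℕ} (hq : q ≤ j + 1) {N : ℕ} (hN : N ≠ 0) :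
    ∃ γ ∈ integralForms Φ (2 * q),
      wedgePow (ofRealForm η) q = ((q.factorial * ∏ i : Fin q, d (Fin.castLE hq i) : ℕ) : ℂ) • γ ∧
      wedgePow (ofRealForm ((N : ℝ) • η)) q = ((q.factorial * ∏ i : Fin q, N * d (Fin.castLE hq i) : ℕ) : ℂ) • γ ∧
      wedgePow (ofRealForm ((((d 0 : ℕ) : ℝ))⁻¹ • η)) q = ((q.factorial * ∏ i : Fin q, d (Fin.castLE hq i) / d 0 : ℕ) : ℂ) • γ := by
  obtain ⟨γ, hγZ, hγ⟩ := h.exists_mem_integralForms_wedgePow_eq_content_smul Φ hq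
  exact ⟨γ, hγZ, hγ, (wedgePow_natCast_smul_eq_content_smul_iff hN hq d η γ).2 hγ,
    (h.wedgePow_inv_smul_first_eq_content_smul_iff Φ (h.pos hη 0) hq γ).2 hγ⟩

/-- **Uniqueness across the ray**: a class `γ` dividing `θ_N^{∧q}` by the content of `N·η` IS the minimal class of `η` (Riemann form, `q ≤ g`).
[cite: Lange2023AbelianVarietiesComplex, §2.5.3 Thm. 2.5.16 (PDF p. 135)] -/
theorem IsSymplecticEnum.eq_of_wedgePow_natCast_smul_eq_content_smul (h : IsSymplecticEnum Φ e₀ η d) (hη : IsRiemannForm Φ η)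
    {q : ℕ} (hq : q ≤ j + 1) {N : ℕ} (hN : N ≠ 0) {γ γ' : E [⋀^Fin (2 * q)]→L[ℝ] ℂ}
    (hγ : wedgePow (ofRealForm η) q = ((q.factorial * ∏ i : Fin q, d (Fin.castLE hq i) : ℕ) : ℂ) • γ)
    (hγ' : wedgePow (ofRealForm ((N : ℝ) • η)) q = ((q.factorial * ∏ i : Fin q, N * d (Fin.castLE hq i) : ℕ) : ℂ) • γ') : γ = γ' :=
  h.eq_of_wedgePow_eq_content_smul Φ hη hq hγ ((wedgePow_natCast_smul_eq_content_smul_iff hN hq d η γ').1 hγ')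

/-- **Uniqueness across the ray, reduced polarisation**: a class dividing `θ'^{∧q}` by the content of `d₁⁻¹·η` is the minimal class of `η`.
[cite: Lange2023AbelianVarietiesComplex, §2.5.3 Thm. 2.5.16 (PDF p. 135); §1.5.1 (PDF pp. 51–52)] -/
theorem IsSymplecticEnum.eq_of_wedgePow_inv_smul_first_eq_content_smul (h : IsSymplecticEnum Φ e₀ η d) (hη : IsRiemannForm Φ η)
    {q : ℕ} (hq : q ≤ j + 1) {γ γ' : E [⋀^Fin (2 * q)]→L[ℝ] ℂ}
    (hγ : wedgePow (ofRealForm η) q = ((q.factorial * ∏ i : Fin q, d (Fin.castLE hq i) : ℕ) : ℂ) • γ)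
    (hγ' : wedgePow (ofRealForm ((((d 0 : ℕ) : ℝ))⁻¹ • η)) q = ((q.factorial * ∏ i : Fin q, d (Fin.castLE hq i) / d 0 : ℕ) : ℂ) • γ') :
    γ = γ' :=
  h.eq_of_wedgePow_eq_content_smul Φ hη hq hγ ((h.wedgePow_inv_smul_first_eq_content_smul_iff Φ (h.pos hη 0) hq γ').1 hγ')

/-- **Basis-free form of the common minimal class** (any presentation of a polarised torus of type `(d₁, …, d_g)`, `g = j + 1`, `q ≤ g`,
`N ≥ 1`): one integral class `γ_q` divides `θ^{∧q}`, `θ_N^{∧q}` and `θ'^{∧q}` by the respective contents.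
[cite: Lange2023AbelianVarietiesComplex, §2.5.3 Thm. 2.5.16 and Cor. 2.5.17 (PDF p. 135); §1.5.1 (PDF pp. 51–52)] [cite: BenoistDebarre2023SmoothSubvarietiesJacobians, §1 (p. 3)] -/
theorem IsPolarizationType.exists_mem_integralForms_wedgePow_eq_content_smul_and_smul {Φ : (ι → ℝ) ≃L[ℝ] E}
    (hd : IsPolarizationType Φ η d) (hη : IsRiemannForm Φ η) {q : ℕ} (hq : q ≤ j + 1) {N : ℕ} (hN : N ≠ 0) :
    ∃ γ ∈ integralForms Φ (2 * q),
      wedgePow (ofRealForm η) q = ((q.factorial * ∏ i : Fin q, d (Fin.castLE hq i) : ℕ) : ℂ) • γ ∧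
      wedgePow (ofRealForm ((N : ℝ) • η)) q = ((q.factorial * ∏ i : Fin q, N * d (Fin.castLE hq i) : ℕ) : ℂ) • γ ∧
      wedgePow (ofRealForm ((((d 0 : ℕ) : ℝ))⁻¹ • η)) q = ((q.factorial * ∏ i : Fin q, d (Fin.castLE hq i) / d 0 : ℕ) : ℂ) • γ := by
  obtain ⟨γ, hγZ, hγ⟩ := hd.exists_mem_integralForms_wedgePow_eq_content_smul hq
  exact ⟨γ, hγZ, hγ, (wedgePow_natCast_smul_eq_content_smul_iff hN hq d η γ).2 hγ,
    (hd.wedgePow_inv_smul_first_eq_content_smul_iff (hd.pos hη 0) hq γ).2 hγ⟩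

end Scaling

end Literature.Geometry.Kaehler.ComplexTorus
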